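import Summits.QuantumFields.YangMills.Theorems.SwapVirialDeficitPeriodicPrincipalLogLimit
import Summits.QuantumFields.YangMills.Theorems.SwapVirialDeficitBlowUpTwoScaleExtract
import HarnessLib

/-!
# The PERIODIC massive-mode rung, brick PM-IV (glue): the fixed-`L` relative gap DIRECTLY from the two-scale CONTRACT (I1′)–(I3′) + `0 < gI`
# (free-hands support of ⟨stmt-QuantumFields-24196⟩ `SwapVirialDeficit.ToronSoftnessSharp`; plugs ✓`BlowUp.twoScale_upper` / ✓`BlowUp.twoScale_lower` (PM-III)
# into ✓`relativeGap_fixedL_of_twoScale'`, so that LEAD ym-line-sfw-p2 g96's PM-I/PM-II deliverable is LITERALLY the hypothesis list below)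

★★★ `relativeGap_fixedL_of_periodicContract`: for every `ε > 0` there is `L₀` such that for `L ≥ L₀`, ANY two-scale fibre mass `V`, profile `M` and bound
`Vmax < ∞` with (I1′) `periodicKernel L 0 1 t t² (a₀, ρ) = 4π·ρ⁻¹·V ρ (t/ρ²) a₀` on `a₀² + ρ² < 1` (`t, ρ > 0`), (I2′) `V ≤ Vmax` on `0 < u ≤ 1, 0 < s, |a₀| ≤ 1`,
`M ≤ Vmax` measurable, (I3′) the locally uniform two-scale limit `V → M` off `a₀ = 0` (both halves), and `0 < gI := (∫⁻_{(−1,1)} 4π·M).toReal`, the fixed-`L`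
conclusion `β·(log Z^S_L)′(β) − β·(log Z^{phys}_L)′(β) ≤ −(1/2 − 2ε)` holds eventually in `β`.  Also `periodicKernel_eq_zero_of_le` ((I1′)'s complement is automatic).
HONEST LABEL: glue (20 lines of logic); PM-I/PM-II (the contract's dischargers) are NOT proved here; ⟨24196⟩/⟨24497⟩ OPEN; own crux ⟨22884⟩ OPEN (blocked-on ⟨19935⟩);
the Yang–Mills mass gap is NOT proved; no summit is proved by a line.  Width seat ym-line-sfw-p2-w3 g64 (cell ym-idea-1, free hands), `--supports stmt-QuantumFields-24196`.
THEOREMS ONLY (0 `def`, 0 `sorry`), standard axioms.  References: [cite: Luscher1983, §2]; [cite: GonzalezarroyoAltes1988]; [folklore].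
-/

set_option autoImplicit false

noncomputable section

open MeasureTheory Quaternion Set Filter Topology
open scoped Quaternion ENNReal BigOperators
open Literature.MathematicalPhysics.QuantumLattice
open Literature.MathematicalPhysics.QuantumFieldTheory hiding SU2
open Summit.QuantumFields.YangMills.Theorems.SwapTwistDeficit.ToronLog

namespace Summit.QuantumFields.YangMills.Theorems.SwapVirialDeficit.BlowUpRing

open Summit.QuantumFields.YangMills.Theorems.FemtoTransferGap
open Summit.QuantumFields.YangMills.Theorems.FemtoTransferGap.TT
open Summit.QuantumFields.YangMills.Theorems.VirialFluxGap.RingDeficit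
open Summit.QuantumFields.YangMills.Theorems.SwapVirialDeficit.BlowUp (tendsto_div_log_of_twoScale)
open Summit.QuantumFields.YangMills.Theorems.SwapVirialDeficit.BlowUp (twoScale_upper twoScale_lower)

variable (L : ℕ) [NeZero L]

/-- (I1′)'s complement is automatic: the periodic kernel vanishes off the unit disc `a₀² + ρ² < 1`. [folklore] -/
theorem periodicKernel_eq_zero_of_le (z : Fin 3 → Bool) (χ : Site 3 L → SU2) (t s a₀ ρ : ℝ) (h : 1 ≤ a₀ ^ 2 + ρ ^ 2) :
    periodicKernel L z χ t s (a₀, ρ) = 0 := by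
  unfold periodicKernel
  rw [Set.indicator_of_notMem (by simpa using h), mul_zero]

/-- ★★★ **THE FIXED-`L` RELATIVE GAP FROM THE TWO-SCALE CONTRACT.** [cite: Luscher1983, §2] [cite: GonzalezarroyoAltes1988] -/
theorem relativeGap_fixedL_of_periodicContract {ε : ℝ} (hε : 0 < ε) :
    ∃ L₀ : ℕ, ∀ (L : ℕ) [NeZero L], L₀ ≤ L →
      ∀ (V : ℝ → ℝ → ℝ → ℝ≥0∞) (M : ℝ → ℝ≥0∞) (Vmax : ℝ≥0∞), Vmax ≠ ∞ →
      (∀ t a₀ ρ : ℝ, 0 < t → 0 < ρ → a₀ ^ 2 + ρ ^ 2 < 1 →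
        periodicKernel L (fun _ => false) (fun _ => 1) t (t ^ 2) (a₀, ρ) = ENNReal.ofReal (4 * Real.pi) * ENNReal.ofReal ρ⁻¹ * V ρ (t / ρ ^ 2) a₀) →
      (∀ u s a₀ : ℝ, 0 < u → u ≤ 1 → 0 < s → |a₀| ≤ 1 → V u s a₀ ≤ Vmax) → Measurable M → (∀ a₀, M a₀ ≤ Vmax) →
      (∀ ε' : ℝ, 0 < ε' → ∀ r₀ ∈ Ioo (0 : ℝ) 1, ∃ θ : ℝ, 0 < θ ∧ ∀ a₀ : ℝ, r₀ ≤ |a₀| → |a₀| ≤ 1 →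
        ∀ u ∈ Ioo (0 : ℝ) θ, ∀ s ∈ Ioo (0 : ℝ) θ, V u s a₀ ≤ M a₀ + ENNReal.ofReal ε') →
      (∀ ε' : ℝ, 0 < ε' → ∀ r₀ ∈ Ioo (0 : ℝ) 1, ∃ θ : ℝ, 0 < θ ∧ ∀ a₀ : ℝ, r₀ ≤ |a₀| → |a₀| ≤ 1 →
        ∀ u ∈ Ioo (0 : ℝ) θ, ∀ s ∈ Ioo (0 : ℝ) θ, M a₀ ≤ V u s a₀ + ENNReal.ofReal ε') →
      0 < (∫⁻ a₀ in Ioo (-1 : ℝ) 1, ENNReal.ofReal (4 * Real.pi) * M a₀ ∂volume).toReal →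
      ∃ β₀ : ℝ, ∀ β : ℝ, β₀ ≤ β →
        β * deriv (fun b : ℝ => Real.log (TT.twistTrace L b (2 * L))) β -
            β * deriv (fun b : ℝ => Real.log (TT.physTrace L b (2 * L))) β ≤ -(1 / 2 - 2 * ε) := by
  obtain ⟨L₀, h⟩ := relativeGap_fixedL_of_twoScale' hε
  refine ⟨L₀, fun L _ hL V M Vmax hVmax hK hV hM hMV hup hlo hgI => h L hL hgI (fun ε' hε' => ?_) (fun ε' hε' => ?_)⟩
  · exact twoScale_upper (fun t p => periodicKernel L (fun _ => false) (fun _ => 1) t (t ^ 2) p) V M hVmax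
      (fun t a₀ ρ ht hρ hin => hK t a₀ ρ ht hρ hin) (fun t a₀ ρ _ _ hle => periodicKernel_eq_zero_of_le L _ _ _ _ a₀ ρ hle) hV hM hMV hup hε'
  · exact twoScale_lower (fun t p => periodicKernel L (fun _ => false) (fun _ => 1) t (t ^ 2) p) V M hVmax
      (fun t a₀ ρ ht hρ hin => hK t a₀ ρ ht hρ hin) hM hMV hlo hε'

end Summit.QuantumFields.YangMills.Theorems.SwapVirialDeficit.BlowUpRing

end
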